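import Literature.Geometry.Riemannian.PinchingEstimatesProofs
import Literature.Geometry.Riemannian.SurgicalSolutions
import HarnessLib

/-!
# The pinching assumption propagates along a restarted stage (Chen–Zhu 2006, §5; Hamilton 1997, §4.3)
(topic `Geometry/Riemannian`)

A brick of the surgery step of Chen–Zhu's Thm. 5.6
(`Literature.Geometry.Riemannian.chenZhu_surgicalStep_admissibleRestart`,
`HamiltonPICDecomposition.lean`; B.-L. Chen, X.-P. Zhu, J. Differential Geom. 74 (2006),
arXiv:math/0504478). The a priori **pinching assumption** of §5 (p. 26, (5.1)–(5.3): Hamilton's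
(2.1)–(2.3) with the constants `ρ, Λ, P` of the initial metric, the improved estimate (5.3) read
at the ABSOLUTE time `t`) is imposed on every stage `g^{(k)}` of a solution with surgery. In the
inductive construction of §5 it is obtained on a new stage `[t_k⁻, t_k⁺)` in two steps: the
surgery at `t_k⁻` preserves it (Lemma 5.3 = Hamilton 1997, Thm. D3.1, "Justification of the
pinching assumption"), and **the Ricci flow of the new stage preserves it from its initial time
on** — Hamilton 1997, §4.3 (= D3), p. 57: "In the section on curvature pinching estimates we
showed that the following estimates are preserved by the Ricci Flow: `a₁ + a₂ ≥ m`, `c₁ + c₂ ≥ m`,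
`(b₂ + b₃)² ≤ Λ(a₁ + a₂)(c₁ + c₂)`, `a₂ + a₃ ≤ Φ(a₁ + a₂)`, …, `a₁ + ρ > 0`, `a₃ ≤ Ψ(a₁ + ρ)`,
`b₃ ≤ H e^{Pt} √((a₁+ρ)(c₁+ρ))`, the two improved estimates", i.e. Hamilton's COMPLETE system
of pinching inequalities, the time-dependent family `HamiltonODE.pinchingFamily`
(`PinchingFamily.lean`), of which Chen–Zhu's (2.1)–(2.3) are consequences (Cors. 1.5, 1.8 and
Thm. 2.3 with `Q ≥ 2`). This file PROVES that second step in the vocabulary of the stages of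
`SurgicalSolutions.lean` (flows time-shifted to start at `0`, absolute initial time `t₀`):

* `HamiltonODE.IsInvariantRel.shift`, `HamiltonODE.IsInvariant.shift`,
  `HamiltonODE.isClosed_track_shift` — Hamilton's ODE `M' = M² + M^#` is autonomous, so a
  forward-invariant time-dependent family `Z` stays forward invariant after the time shift
  `t ↦ Z (t₀ + t)`, `t₀ ≥ 0`, and its space-time track stays closed.
* `mem_of_ricciFlow_of_mem_shift` — **the maximum principle from a later absolute time**: for a
  Ricci flow of Riemannian metrics `(g, cov)` on `[0, T)` on a closed 4-manifold and a family `Z`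
  as in `hamilton_maximumPrinciple_curvatureODE` (closed, convex, closed track, symmetric under
  `B ↦ -B`, forward invariant), if the blocks of `g 0` lie in `Z t₀` in every orthonormal frame
  then the blocks of `g t` lie in `Z (t₀ + t)` (the discharged maximum principle
  `hamilton_maximumPrinciple_curvatureODE_holds` applied to the shifted family).
* `exists_pinchingFamily_of_hasPositiveIsotropicCurvature` — **the constants of the initial
  metric** (Hamilton 1997, proof of Thm. 1.1, pp. 7–21, as assembled in
  `PinchingEstimatesAssembly.lean`, with every ODE hypothesis now a theorem of the tree): a
  Riemannian PIC metric `g₀` on a closed 4-manifold admits constants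
  `m, Λ, Φ, ρ₁, ρ, Ψ, K, L, P, Q` (with the side conditions used below) for which Hamilton's
  family is forward invariant under the ODE and contains the blocks of `g₀` at time `0`, for
  every Levi-Civita connection and every orthonormal frame.
* `mem_pinchingFamily_of_ricciFlow` (`'`: initial blocks for any Levi-Civita connection) —
  **Hamilton's family propagates along a restarted stage**: blocks of `g 0` in
  `pinchingFamily … t₀` everywhere ⇒ blocks of `g t` in `pinchingFamily … (t₀ + t)` everywhere,
  `t ∈ [0, T)`; `exists_forall_mem_pinchingFamily_of_ricciFlow` — the first stage (`t₀ = 0`,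
  constants of `g 0`): the form of the base case that the first surgery consumes.
* `pinchedBy_and_improvedPinchingAt_of_mem_pinchingFamily` — read-off: membership at time `s`
  gives Chen–Zhu's (2.1)–(2.3) at time `s` with constants `(ρ, max{(Φ+1)(Ψ+1), L}, P)`
  (`Matrix.PinchedBy`, `Matrix.ImprovedPinchingAt` of `PinchingEstimates.lean`), and
  `a₁ + a₂ ≥ m`, `c₁ + c₂ ≥ m`.
* `stage_pinching_of_mem_pinchingFamily`, `stage_hasPositiveIsotropicCurvature_of_mem_pinchingFamily`
  — **the `pinching` and `pic` clauses of the a priori assumptions `ChenZhuAPriori`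
  (`SurgicalSolutions.lean`) for a stage restarted at absolute time `t₀`** whose initial blocks
  lie in `pinchingFamily … t₀`: (2.1)–(2.2) and (2.3) at absolute time `t₀ + t`, and positive
  isotropic curvature of every `g t` (Hamilton 1997, Lemma A2.1,
  `hasPositiveIsotropicCurvatureWith_of_blocks`).

Everything here is proved; no definitions and no named facts are introduced. What this leaves
of the pinching half of the surgery step is exactly Lemma 5.3 / Thm. D3.1: membership in
`pinchingFamily … t_k⁻` of the blocks of the surgically modified metric.

## References

* B.-L. Chen, X.-P. Zhu, *Ricci flow with surgery on four-manifolds with positive isotropic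
  curvature*, J. Differential Geom. 74 (2006) 177–264 (arXiv:math/0504478): §2, Lemma 2.1
  ((2.1)–(2.3), p. 4); §5, Def. 5.1 and the a priori assumptions (5.1)–(5.3) (p. 26); Lemma 5.3
  (p. 29). [ChenZhu2006]
* R. S. Hamilton, *Four-manifolds with positive isotropic curvature*, Comm. Anal. Geom. 5 (1997)
  1–92: §2 (Section B), Thms. 1.1–2.3 (pp. 7–21); §4.3 (Section D3), p. 57 and Thm. 3.1 (= D3.1).
  [Hamilton1997]
* R. S. Hamilton, *Four-manifolds with positive curvature operator*, J. Differential Geom. 24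
  (1986), §4, Thm. 4.3. [Hamilton1986]
-/

noncomputable section

open Set Real
open scoped Manifold ContDiff Topology Matrix

namespace Literature.Geometry.Riemannian

open Lorentzian Lorentzian.PseudoRiemannianMetric HamiltonODE

/-! ### Time shifts of forward-invariant families (the ODE is autonomous) -/

namespace HamiltonODE

variable {F : Blocks → Blocks} {K Z : ℝ → Set Blocks}

/-- Translating the time variable of an entrywise differentiable curve of block triples.
[folklore] -/
theorem HasDerivAt.comp_sub_const {γ : ℝ → Blocks} {γ' : Blocks} {t : ℝ} (c : ℝ)
    (h : HasDerivAt γ γ' (t - c)) : HasDerivAt (fun s ↦ γ (s - c)) γ' t :=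
  ⟨fun i j ↦ (h.1 i j).comp_sub_const t c, fun i j ↦ (h.2.1 i j).comp_sub_const t c,
    fun i j ↦ (h.2.2 i j).comp_sub_const t c⟩

/-- A solution of the autonomous system `γ' = F(γ)` on `[a, b]`, translated in time by `c`, is a
solution on `[c + a, c + b]`. [folklore] -/
theorem IsSolutionOn.comp_sub_const {γ : ℝ → Blocks} {a b : ℝ} (h : IsSolutionOn F γ (Icc a b))
    (c : ℝ) : IsSolutionOn F (fun s ↦ γ (s - c)) (Icc (c + a) (c + b)) := by
  intro s hs
  have hs' : s - c ∈ Icc a b := ⟨by linarith [hs.1], by linarith [hs.2]⟩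
  exact HasDerivAt.comp_sub_const c (h (s - c) hs')

/-- **Time shift of relative forward invariance.** If `Z` is forward invariant under the
autonomous system `γ' = F(γ)` relative to `K` (over initial times `≥ 0`), then for `c ≥ 0` the
shifted family `t ↦ Z (c + t)` is forward invariant relative to `t ↦ K (c + t)`: a constrained
solution on `[t₀, t₁]` for the shifted families is, after translating time by `c`, a constrained
solution on `[c + t₀, c + t₁]` for the original ones. [folklore] -/
theorem IsInvariantRel.shift (h : IsInvariantRel F K Z) {c : ℝ} (hc : 0 ≤ c) :
    IsInvariantRel F (fun t ↦ K (c + t)) (fun t ↦ Z (c + t)) := by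
  intro γ t₀ t₁ h₀ h₁ hγ hK hin
  have hsol : IsSolutionOn F (fun s ↦ γ (s - c)) (Icc (c + t₀) (c + t₁)) := hγ.comp_sub_const c
  have hK' : ∀ s ∈ Icc (c + t₀) (c + t₁), (fun s ↦ γ (s - c)) s ∈ K s := by
    intro s hs
    have hs' : s - c ∈ Icc t₀ t₁ := ⟨by linarith [hs.1], by linarith [hs.2]⟩
    have := hK (s - c) hs'
    simpa only [add_sub_cancel] using this
  have hin' : (fun s ↦ γ (s - c)) (c + t₀) ∈ Z (c + t₀) := by
    simpa only [add_sub_cancel_left] using hin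
  have := h (fun s ↦ γ (s - c)) (c + t₀) (c + t₁) (by linarith) (by linarith) hsol hK' hin'
  simpa only [add_sub_cancel_left] using this

/-- **Time shift of forward invariance** (no constraint). [folklore] -/
theorem IsInvariant.shift (h : IsInvariant F Z) {c : ℝ} (hc : 0 ≤ c) :
    IsInvariant F (fun t ↦ Z (c + t)) :=
  IsInvariantRel.shift h hc

/-- The space-time track over `t ≥ 0` of the shifted family is closed if that of `Z` is
(`c ≥ 0`). [folklore] -/
theorem isClosed_track_shift (hZ : IsClosed {q : ℝ × Blocks | 0 ≤ q.1 ∧ q.2 ∈ Z q.1}) {c : ℝ}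
    (hc : 0 ≤ c) : IsClosed {q : ℝ × Blocks | 0 ≤ q.1 ∧ q.2 ∈ Z (c + q.1)} := by
  have hcont : Continuous fun q : ℝ × Blocks ↦ ((c + q.1, q.2) : ℝ × Blocks) :=
    (continuous_const.add continuous_fst).prodMk continuous_snd
  have heq : {q : ℝ × Blocks | 0 ≤ q.1 ∧ q.2 ∈ Z (c + q.1)} =
      {q : ℝ × Blocks | 0 ≤ q.1} ∩
        (fun q : ℝ × Blocks ↦ ((c + q.1, q.2) : ℝ × Blocks)) ⁻¹'
          {q : ℝ × Blocks | 0 ≤ q.1 ∧ q.2 ∈ Z q.1} := by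
    ext q
    simp only [mem_setOf_eq, mem_inter_iff, mem_preimage]
    constructor
    · rintro ⟨hq, hmem⟩
      exact ⟨hq, by linarith, hmem⟩
    · rintro ⟨hq, -, hmem⟩
      exact ⟨hq, hmem⟩
  rw [heq]
  exact (isClosed_le continuous_const continuous_fst).inter (hZ.preimage hcont)

end HamiltonODE

/-! ### The maximum principle from a later absolute time -/

universe u

section Shifted

variable {M : Type u} [TopologicalSpace M] [T2Space M] [SecondCountableTopology M]
  [CompactSpace M] [ChartedSpace (EuclideanSpace ℝ (Fin 4)) M] [IsManifold (𝓡 4) ∞ M] {T : ℝ}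
  {g : ℝ → PseudoRiemannianMetric (𝓡 4) ∞ (EuclideanSpace ℝ (Fin 4))
    (TangentSpace (𝓡 4) : M → Type _)}
  {cov : ℝ → CovariantDerivative (𝓡 4) (EuclideanSpace ℝ (Fin 4))
    (TangentSpace (𝓡 4) : M → Type _)}

/-- **Hamilton's maximum principle for the curvature ODE, started at a later absolute time.**
For a Ricci flow of Riemannian metrics `(g, cov)` on `[0, T)` on a closed 4-manifold and a
time-dependent family `Z` of closed convex sets of block triples, symmetric under `B ↦ -B`, with
closed space-time track over `t ≥ 0` and forward invariant under Hamilton's ODE: if `t₀ ≥ 0` and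
the blocks of `(g 0, cov 0)` lie in `Z t₀` in every `g 0`-orthonormal frame, then the blocks of
`(g t, cov t)` lie in `Z (t₀ + t)` in every `g t`-orthonormal frame, for every `t ∈ [0, T)`.
(The flow of a stage of a surgical solution is time-shifted to start at `0` while the pinching
sets are read at absolute time, `SurgicalSolutions.lean`; the ODE being autonomous, the shifted
family `t ↦ Z (t₀ + t)` satisfies the hypotheses of `hamilton_maximumPrinciple_curvatureODE`,
which is a theorem of the tree, `hamilton_maximumPrinciple_curvatureODE_holds`.)
[cite: Hamilton1986, §4, Thm. 4.3 (p. 162)] [cite: Hamilton1997, §4.3, p. 57] -/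
theorem mem_of_ricciFlow_of_mem_shift (hflow : IsRicciFlow g cov (Ico 0 T))
    (hRiem : ∀ t ∈ Ico 0 T, (g t).IsRiemannian) {Z : ℝ → Set Blocks}
    (hcl : ∀ t, IsClosed (Z t)) (hconv : ∀ t, Convex ℝ (Z t))
    (htrack : IsClosed {q : ℝ × Blocks | 0 ≤ q.1 ∧ q.2 ∈ Z q.1})
    (hrefl : ∀ t, ∀ p ∈ Z t, reflectB p ∈ Z t) (hinv : IsInvariant field Z) {t₀ : ℝ}
    (ht₀ : 0 ≤ t₀)
    (h0 : ∀ (x : M) (e : Fin 4 → TangentSpace (𝓡 4) x), (g 0).IsOrthonormalFrame x e →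
      ((g 0).blockA (cov 0) x e, (g 0).blockB (cov 0) x e, (g 0).blockC (cov 0) x e) ∈ Z t₀) :
    ∀ t ∈ Ico 0 T, ∀ (x : M) (e : Fin 4 → TangentSpace (𝓡 4) x), (g t).IsOrthonormalFrame x e →
      ((g t).blockA (cov t) x e, (g t).blockB (cov t) x e, (g t).blockC (cov t) x e) ∈
        Z (t₀ + t) := by
  have hMP := hamilton_maximumPrinciple_curvatureODE_holds M T g cov hflow hRiem
    (fun t ↦ Z (t₀ + t)) (fun t ↦ hcl _) (fun t ↦ hconv _) (isClosed_track_shift htrack ht₀)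
    (fun t p hp ↦ hrefl _ p hp) (hinv.shift ht₀)
  simp only [add_zero] at hMP
  exact hMP h0

end Shifted

/-! ### Hamilton's family: constants of the initial metric, propagation, read-off -/

namespace HamiltonODE

variable {m Λ Φ ρ₁ ρ Ψ K L P Q : ℝ}

/-- **Read-off of Chen–Zhu's (2.1)–(2.3) from membership in Hamilton's family at time `s`**,
with the constants `(ρ, max{(Φ+1)(Ψ+1), L}, P)` (Cors. 1.5, 1.8 and Thm. 2.3 with `Q ≥ 2`,
`maxLE_and_pinchedBy_of_mem`, `ImprovedPinchingQ.improvedPinchingAt`), together with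
`a₁ + a₂ ≥ m`, `c₁ + c₂ ≥ m`. [cite: Hamilton1997, §2, Cors. 1.5, 1.8 and Thm. 2.3]
[cite: ChenZhu2006, §2, Lemma 2.1, (2.1)–(2.3)] -/
theorem pinchedBy_and_improvedPinchingAt_of_mem_pinchingFamily {s : ℝ} {p : Blocks}
    (hm : 0 < m) (hΛ : 0 < Λ) (hΦ : Λ + 1 ≤ Φ) (hρ₁ : 0 ≤ ρ₁) (hρ : ρ₁ < ρ) (hL : 0 ≤ L)
    (hQ : 2 ≤ Q) (hp : p ∈ pinchingFamily m Λ Φ ρ₁ ρ Ψ K L P Q s) :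
    Matrix.PinchedBy p.1 p.2.1 p.2.2 ρ (max ((Φ + 1) * (Ψ + 1)) L) ∧
      Matrix.ImprovedPinchingAt p.1 p.2.1 p.2.2 ρ (max ((Φ + 1) * (Ψ + 1)) L) P s ∧
      p.1.TwoSmallestEigenvaluesSumGE m ∧ p.2.2.TwoSmallestEigenvaluesSumGE m := by
  obtain ⟨-, hpin⟩ := maxLE_and_pinchedBy_of_mem hm hΛ hΦ hρ₁ hρ hp
  obtain ⟨⟨⟨⟨⟨⟨⟨⟨⟨⟨⟨-, h1⟩, h2⟩, -⟩, -⟩, -⟩, -⟩, -⟩, -⟩, -⟩, -⟩, h11⟩ := hp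
  have h23 : ImprovedPinchingQ p ρ L P Q s := h11
  exact ⟨hpin.mono (le_max_left _ _), (h23.improvedPinchingAt hL hQ).mono (le_max_right _ _),
    h1, h2⟩

end HamiltonODE

section Family

variable {M : Type u} [TopologicalSpace M] [T2Space M] [SecondCountableTopology M]
  [CompactSpace M] [ChartedSpace (EuclideanSpace ℝ (Fin 4)) M] [IsManifold (𝓡 4) ∞ M]

omit [SecondCountableTopology M] in
/-- **The pinching constants of the initial metric** (Hamilton 1997, proof of Thm. 1.1,
pp. 7–21, as assembled in `hamilton_chenZhu_pinching_of_ode`; every ODE hypothesis there is now a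
theorem of the tree: Thms. 1.2, 1.3, 1.4, 1.6, 1.7, 1.9, 2.1, 2.3). For a Riemannian metric `g₀`
of positive isotropic curvature on a closed 4-manifold there are constants
`m, Λ > 0`, `Φ ≥ Λ + 1`, `0 ≤ ρ₁ < ρ`, `Ψ ≥ 0`, `K ≥ 0`, `L, P > 0`, `Q ≥ 2` such that Hamilton's
complete family of pinching inequalities `pinchingFamily m Λ Φ ρ₁ ρ Ψ K L P Q` is forward
invariant under the curvature ODE and contains, at time `0`, the blocks of `g₀` in every
`g₀`-orthonormal frame, for every Levi-Civita connection of `g₀` (chosen from the curvature bound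
`K₀` of `g₀` and its uniform PIC constant `m`: `Λ = 4K₀²/m² + 1`, `Φ = Λ + 1 + 2K₀/m`,
`ρ₁ = K₀ + 1/2`, `ρ = K₀ + 1`, `Ψ = 4(Φ+1)² + 1 + K₀`, then `K`, `Q`, `L`, `P` from Thms. 2.1,
2.3, 1.9 and the initial fit, `PinchingEstimatesInitialFit.lean`).
[cite: Hamilton1997, §2, Thm. 1.1 (proof, pp. 7–21)] [cite: ChenZhu2006, §2, Lemma 2.1] -/
theorem exists_pinchingFamily_of_hasPositiveIsotropicCurvature
    (g₀ : PseudoRiemannianMetric (𝓡 4) ∞ (EuclideanSpace ℝ (Fin 4))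
      (TangentSpace (𝓡 4) : M → Type _))
    (hg₀ : g₀.IsRiemannian) (hPIC : g₀.HasPositiveIsotropicCurvature) :
    ∃ m Λ Φ ρ₁ ρ Ψ K L P Q : ℝ,
      (0 < m ∧ 0 < Λ ∧ Λ + 1 ≤ Φ ∧ 0 ≤ ρ₁ ∧ ρ₁ < ρ ∧ 0 ≤ Ψ ∧ 0 ≤ K ∧ 0 < L ∧ 0 < P ∧ 2 ≤ Q) ∧
      IsInvariant field (pinchingFamily m Λ Φ ρ₁ ρ Ψ K L P Q) ∧
      ∀ (cov : CovariantDerivative (𝓡 4) (EuclideanSpace ℝ (Fin 4))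
        (TangentSpace (𝓡 4) : M → Type _)), g₀.IsLeviCivita cov →
        ∀ (x : M) (e : Fin 4 → TangentSpace (𝓡 4) x), g₀.IsOrthonormalFrame x e →
          (g₀.blockA cov x e, g₀.blockB cov x e, g₀.blockC cov x e) ∈
            pinchingFamily m Λ Φ ρ₁ ρ Ψ K L P Q 0 := by
  haveI : LocallyCompactSpace M := ChartedSpace.locallyCompactSpace (EuclideanSpace ℝ (Fin 4)) M
  obtain ⟨K₀, hK₀, hbd'⟩ := exists_blocks_bound hg₀
  obtain ⟨m, hm, hpic'⟩ := exists_pic_bound hg₀ hPIC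
  -- Hamilton's constants, as in `hamilton_chenZhu_pinching_of_ode`
  set Λ : ℝ := 4 * K₀ ^ 2 / m ^ 2 + 1 with hΛdef
  have hΛ : 0 < Λ := by positivity
  set Φ : ℝ := Λ + 1 + 2 * K₀ / m with hΦdef
  have h2K : 0 ≤ 2 * K₀ / m := by positivity
  have hΦ : Λ + 1 ≤ Φ := by rw [hΦdef]; linarith
  have hΞ : 0 < Φ + 1 := by linarith
  set ρ : ℝ := K₀ + 1 with hρdef
  set Ψ : ℝ := 4 * (Φ + 1) ^ 2 + 1 + K₀ with hΨdef
  have hΨ0 : 0 ≤ Ψ := by positivity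
  set Ω : ℝ := (Φ + 1) * (Ψ + 1) with hΩdef
  have hΩ : 0 < Ω := by positivity
  obtain ⟨K₁, hK₁⟩ := hamilton1997_B21_ode m Λ (Φ + 1) hm hΛ hΞ
  set K : ℝ := max (max K₁ 0) (2 * K₀ * max (2 * K₀) 2 / m) with hKdef
  have hK0 : 0 ≤ K := (le_max_right _ _).trans (le_max_left _ _)
  obtain ⟨Q, hQ, L₀, P₀, h23'⟩ := hamilton1997_B23_ode m Λ (Φ + 1) ρ Ω K hm hΛ hΞ (by positivity) hΩ
  set L : ℝ := max (max L₀ (2 * K₀ + 1)) (K₀ * max (2 * K₀ + 1) Q) with hLdef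
  have hL0 : 0 < L := lt_of_lt_of_le (by positivity) ((le_max_right _ _).trans (le_max_left _ _))
  set P : ℝ := max (max P₀ (4 * Ω * ρ)) 1 with hPdef
  have hP0 : 0 < P := lt_of_lt_of_le one_pos (le_max_right _ _)
  have hQ0 : 0 < Q := by linarith
  have hn : (2 : ℕ∞ω) ≤ ∞ := WithTop.coe_le_coe.mpr le_top
  -- forward invariance of the family, from the eight ODE theorems
  have hinv : IsInvariant field (pinchingFamily m Λ Φ (K₀ + 1 / 2) ρ Ψ K L P Q) :=
    isInvariant_pinchingFamily hm hΛ hΦ (by positivity) (by rw [hρdef]; linarith)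
      ⟨isInvariantRel_twoSmallest_fst hm, isInvariantRel_twoSmallest_snd hm⟩
      (hamilton1997_B13_ode m Λ hm hΛ) (hamilton1997_B14_ode m Λ Φ hm hΛ hΦ)
      ⟨isInvariantRel_smallestAddNonneg_fst hm (K₀ + 1 / 2),
        isInvariantRel_smallestAddNonneg_snd hm (K₀ + 1 / 2)⟩
      (hamilton1997_B17_ode m (Φ + 1) ρ Ψ hm hΞ (by rw [hΨdef]; linarith))
      (hamilton1997_B19_ode m ρ ((Φ + 1) * (Ψ + 1)) P (L / 2) hm (by positivity) hΩ
        ((le_max_right _ _).trans (le_max_left _ _)) (by linarith))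
      (hK₁ K ((le_max_left _ _).trans (le_max_left _ _)) hK0)
      (h23' L P ((le_max_left _ _).trans (le_max_left _ _))
        ((le_max_left _ _).trans (le_max_left _ _)) hL0 hP0)
  refine ⟨m, Λ, Φ, K₀ + 1 / 2, ρ, Ψ, K, L, P, Q,
    ⟨hm, hΛ, hΦ, by positivity, by rw [hρdef]; linarith, hΨ0, hK0, hL0, hP0, hQ⟩, hinv, ?_⟩
  -- the blocks of the initial metric lie in the family at time `0`
  intro cov hLC x e he
  have hb := hbd' cov hLC x e he
  obtain ⟨hA, hC⟩ := hpic' cov hLC x e he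
  set p : Blocks := (g₀.blockA cov x e, g₀.blockB cov x e, g₀.blockC cov x e) with hpdef
  have hb' : ∀ u v : Fin 3 → ℝ, u ⬝ᵥ u = 1 → v ⬝ᵥ v = 1 → |u ⬝ᵥ (p.1 *ᵥ v)| ≤ K₀ ∧
      |u ⬝ᵥ (p.2.1 *ᵥ v)| ≤ K₀ ∧ |u ⬝ᵥ (p.2.2 *ᵥ v)| ≤ K₀ := hb
  have hA' : p.1.TwoSmallestEigenvaluesSumGE m := hA
  have hC' : p.2.2.TwoSmallestEigenvaluesSumGE m := hC
  have hΛm : 4 * K₀ ^ 2 ≤ Λ * m ^ 2 := by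
    rw [hΛdef, add_mul, div_mul_cancel₀ _ (by positivity)]; nlinarith
  have hΦm : 2 * K₀ ≤ Φ * m := by
    rw [hΦdef, add_mul, div_mul_cancel₀ _ hm.ne']
    nlinarith [hΛ.le]
  have hKm : 2 * K₀ * max (2 * K₀) 2 ≤ K * m := by
    have : 2 * K₀ * max (2 * K₀) 2 / m * m ≤ K * m :=
      mul_le_mul_of_nonneg_right (le_max_right _ _) hm.le
    rwa [div_mul_cancel₀ _ hm.ne'] at this
  have h17 := InitialFit.largestLESmallestAdd (Ψ := Ψ) (ρ := ρ) hb' le_rfl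
    (by rw [hΨdef]; nlinarith)
  refine ⟨⟨⟨⟨⟨⟨⟨⟨⟨⟨⟨?_, hA'⟩, hC'⟩, ?_⟩, ?_⟩, ?_⟩, ?_⟩, ?_⟩, h17⟩, ?_⟩, ?_⟩, ?_⟩
  · exact ⟨blockA_isSymm hLC hn x e, blockC_isSymm hLC hn x e⟩
  · exact InitialFit.singularValuesSumSqLE hm hb' hA' hC' hΛm hΛ.le
  · exact trace_blockA_eq_trace_blockC hLC hn x e
  · exact ⟨InitialFit.twoLargestA hK₀ hm hb' hA' hΦm, InitialFit.twoLargestC hK₀ hm hb' hC' hΦm⟩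
  · exact (InitialFit.smallestAddNonneg hb' (by linarith)).1
  · exact (InitialFit.smallestAddNonneg hb' (by linarith)).2
  · exact InitialFit.singularValueLEExp hb' le_rfl
        (by rw [hLdef]; linarith [le_max_left (max L₀ (2 * K₀ + 1)) (K₀ * max (2 * K₀ + 1) Q),
          le_max_right L₀ (2 * K₀ + 1)])
  · exact InitialFit.improvedPinching hK₀ hm hb' hA' hC' hKm hK0
  · exact InitialFit.improvedPinchingQ hK₀ hb' hQ0 (le_max_right _ _) hL0.le

variable {T : ℝ}
  {g : ℝ → PseudoRiemannianMetric (𝓡 4) ∞ (EuclideanSpace ℝ (Fin 4))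
    (TangentSpace (𝓡 4) : M → Type _)}
  {cov : ℝ → CovariantDerivative (𝓡 4) (EuclideanSpace ℝ (Fin 4))
    (TangentSpace (𝓡 4) : M → Type _)}
  {m Λ Φ ρ₁ ρ Ψ K L P Q : ℝ}

/-- **Hamilton's family of pinching inequalities propagates along a restarted stage** (Hamilton
1997, §4.3, p. 57: "the following estimates are preserved by the Ricci Flow"; the invariant of
the inductive construction of Chen–Zhu 2006, §5, behind the pinching assumption (5.1)–(5.3),
p. 26). For a Ricci flow of Riemannian metrics `(g, cov)` on `[0, T)` on a closed 4-manifold, if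
the blocks of `(g 0, cov 0)` lie in `pinchingFamily m Λ Φ ρ₁ ρ Ψ K L P Q t₀` (`t₀ ≥ 0`, the
absolute initial time of the stage) in every orthonormal frame, and the family is forward
invariant under the curvature ODE with admissible constants (`m, Λ, K, L ≥ 0`, `ρ₁ ≤ ρ`,
`Q ≥ 2`), then the blocks of `(g t, cov t)` lie in `pinchingFamily … (t₀ + t)` in every
orthonormal frame, `t ∈ [0, T)`. [cite: Hamilton1997, §4.3, p. 57] [cite: ChenZhu2006, §5, p. 26 (pinching assumption)] -/
theorem mem_pinchingFamily_of_ricciFlow (hflow : IsRicciFlow g cov (Ico 0 T))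
    (hRiem : ∀ t ∈ Ico 0 T, (g t).IsRiemannian) (hm : 0 ≤ m) (hΛ : 0 ≤ Λ) (hρ : ρ₁ ≤ ρ)
    (hK : 0 ≤ K) (hL : 0 ≤ L) (hQ : 2 ≤ Q)
    (hinv : IsInvariant field (pinchingFamily m Λ Φ ρ₁ ρ Ψ K L P Q)) {t₀ : ℝ} (ht₀ : 0 ≤ t₀)
    (h0 : ∀ (x : M) (e : Fin 4 → TangentSpace (𝓡 4) x), (g 0).IsOrthonormalFrame x e →
      ((g 0).blockA (cov 0) x e, (g 0).blockB (cov 0) x e, (g 0).blockC (cov 0) x e) ∈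
        pinchingFamily m Λ Φ ρ₁ ρ Ψ K L P Q t₀) :
    ∀ t ∈ Ico 0 T, ∀ (x : M) (e : Fin 4 → TangentSpace (𝓡 4) x), (g t).IsOrthonormalFrame x e →
      ((g t).blockA (cov t) x e, (g t).blockB (cov t) x e, (g t).blockC (cov t) x e) ∈
        pinchingFamily m Λ Φ ρ₁ ρ Ψ K L P Q (t₀ + t) := by
  have hQ0 : 0 < Q := by linarith
  exact mem_of_ricciFlow_of_mem_shift hflow hRiem (isClosed_pinchingFamily hQ0)
    (convex_pinchingFamily hm hΛ hρ hK hL hQ) (isClosed_pinchingFamily_track hQ0)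
    (fun _ _ hp ↦ reflectB_mem_pinchingFamily hp) hinv ht₀ h0

/-- The initial hypothesis of `mem_pinchingFamily_of_ricciFlow` may be checked with ANY
Levi-Civita connection of the initial metric (the blocks do not depend on that choice,
`blocks_eq_of_isLeviCivita`) — the form in which the surgery lemma delivers it.
[cite: Hamilton1997, §4.3, p. 57] -/
theorem mem_pinchingFamily_of_ricciFlow' (hflow : IsRicciFlow g cov (Ico 0 T))
    (hRiem : ∀ t ∈ Ico 0 T, (g t).IsRiemannian) (hm : 0 ≤ m) (hΛ : 0 ≤ Λ) (hρ : ρ₁ ≤ ρ)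
    (hK : 0 ≤ K) (hL : 0 ≤ L) (hQ : 2 ≤ Q)
    (hinv : IsInvariant field (pinchingFamily m Λ Φ ρ₁ ρ Ψ K L P Q)) {t₀ : ℝ} (ht₀ : 0 ≤ t₀)
    {cov₀ : CovariantDerivative (𝓡 4) (EuclideanSpace ℝ (Fin 4))
      (TangentSpace (𝓡 4) : M → Type _)} (hcov₀ : (g 0).IsLeviCivita cov₀)
    (h0 : ∀ (x : M) (e : Fin 4 → TangentSpace (𝓡 4) x), (g 0).IsOrthonormalFrame x e →
      ((g 0).blockA cov₀ x e, (g 0).blockB cov₀ x e, (g 0).blockC cov₀ x e) ∈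
        pinchingFamily m Λ Φ ρ₁ ρ Ψ K L P Q t₀) :
    ∀ t ∈ Ico 0 T, ∀ (x : M) (e : Fin 4 → TangentSpace (𝓡 4) x), (g t).IsOrthonormalFrame x e →
      ((g t).blockA (cov t) x e, (g t).blockB (cov t) x e, (g t).blockC (cov t) x e) ∈
        pinchingFamily m Λ Φ ρ₁ ρ Ψ K L P Q (t₀ + t) := by
  intro t ht
  have h00 : (0 : ℝ) ∈ Ico 0 T := ⟨le_rfl, ht.1.trans_lt ht.2⟩
  refine mem_pinchingFamily_of_ricciFlow hflow hRiem hm hΛ hρ hK hL hQ hinv ht₀ ?_ t ht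
  intro x e he
  obtain ⟨hA, hB, hC⟩ := blocks_eq_of_isLeviCivita hcov₀ (hflow.isLeviCivita 0 h00) x e
  rw [hA, hB, hC]
  exact h0 x e he

/-- **The first stage** (base of the induction of Chen–Zhu 2006, §5, p. 26, in the form the
surgery step consumes): along a Ricci flow of Riemannian metrics on `[0, T)` on a closed
4-manifold whose initial metric has positive isotropic curvature, the blocks stay in Hamilton's
family `pinchingFamily … t` at the flow's own time `t`, for the constants of the initial metric
(`exists_pinchingFamily_of_hasPositiveIsotropicCurvature`). This refines
`hamilton_chenZhu_pinching` (which records only (2.1)–(2.3)) by the auxiliary estimates of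
Hamilton's list, which are what the maximum principle — and the surgery, Thm. D3.1 — propagate.
[cite: Hamilton1997, §2, Thm. 1.1 (proof, pp. 7–21) and §4.3, p. 57] [cite: ChenZhu2006, §5, p. 26] -/
theorem exists_forall_mem_pinchingFamily_of_ricciFlow (hT : 0 < T)
    (hflow : IsRicciFlow g cov (Ico 0 T)) (hRiem : ∀ t ∈ Ico 0 T, (g t).IsRiemannian)
    (hPIC : (g 0).HasPositiveIsotropicCurvature) :
    ∃ m Λ Φ ρ₁ ρ Ψ K L P Q : ℝ,
      (0 < m ∧ 0 < Λ ∧ Λ + 1 ≤ Φ ∧ 0 ≤ ρ₁ ∧ ρ₁ < ρ ∧ 0 ≤ Ψ ∧ 0 ≤ K ∧ 0 < L ∧ 0 < P ∧ 2 ≤ Q) ∧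
      IsInvariant field (pinchingFamily m Λ Φ ρ₁ ρ Ψ K L P Q) ∧
      ∀ t ∈ Ico 0 T, ∀ (x : M) (e : Fin 4 → TangentSpace (𝓡 4) x),
        (g t).IsOrthonormalFrame x e →
          ((g t).blockA (cov t) x e, (g t).blockB (cov t) x e, (g t).blockC (cov t) x e) ∈
            pinchingFamily m Λ Φ ρ₁ ρ Ψ K L P Q t := by
  have h00 : (0 : ℝ) ∈ Ico 0 T := ⟨le_rfl, hT⟩
  obtain ⟨m, Λ, Φ, ρ₁, ρ, Ψ, K, L, P, Q, ⟨hm, hΛ, hΦ, hρ₁, hρ, hΨ, hK, hL, hP, hQ⟩, hinv, hin⟩ :=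
    exists_pinchingFamily_of_hasPositiveIsotropicCurvature (g 0) (hRiem 0 h00) hPIC
  refine ⟨m, Λ, Φ, ρ₁, ρ, Ψ, K, L, P, Q, ⟨hm, hΛ, hΦ, hρ₁, hρ, hΨ, hK, hL, hP, hQ⟩, hinv, ?_⟩
  intro t ht
  simpa only [zero_add] using mem_pinchingFamily_of_ricciFlow hflow hRiem hm.le hΛ.le hρ.le hK
    hL.le hQ hinv le_rfl (hin (cov 0) (hflow.isLeviCivita 0 h00)) t ht

end Family

/-! ### The `pinching` and `pic` clauses of the a priori assumptions of a restarted stage -/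

section Stage

variable {M : Type u} [TopologicalSpace M] [T2Space M] [SecondCountableTopology M]
  [CompactSpace M] [ChartedSpace (EuclideanSpace ℝ (Fin 4)) M] [IsManifold (𝓡 4) ∞ M] {T : ℝ}
  {g : ℝ → PseudoRiemannianMetric (𝓡 4) ∞ (EuclideanSpace ℝ (Fin 4))
    (TangentSpace (𝓡 4) : M → Type _)}
  {cov : ℝ → CovariantDerivative (𝓡 4) (EuclideanSpace ℝ (Fin 4))
    (TangentSpace (𝓡 4) : M → Type _)}
  {m Λ Φ ρ₁ ρ Ψ K L P Q : ℝ}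

/-- **The pinching assumption (5.1)–(5.3) of a restarted stage** (Chen–Zhu 2006, §5, p. 26, the
`pinching` clause of `ChenZhuAPriori` in `SurgicalSolutions.lean`, with parameters
`ρ`, `Λ' = max{(Φ+1)(Ψ+1), L}`, `P`): if the stage `(g, cov)` on `[0, T)`, started at absolute
time `t₀ ≥ 0`, has its initial blocks in Hamilton's family `pinchingFamily … t₀` (after a
surgery: Lemma 5.3 / Hamilton's Thm. D3.1), then at every `t ∈ [0, T)`, every point and every
`g t`-orthonormal frame the blocks satisfy (2.1)–(2.2) (`Matrix.PinchedBy … ρ Λ'`) and (2.3) at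
the absolute time `t₀ + t` (`Matrix.ImprovedPinchingAt … ρ Λ' P (t₀ + t)`).
[cite: ChenZhu2006, §5, p. 26 (pinching assumption (5.1)–(5.3))] [cite: Hamilton1997, §4.3, p. 57 and Thm. 3.1 (= D3.1)] -/
theorem stage_pinching_of_mem_pinchingFamily (hflow : IsRicciFlow g cov (Ico 0 T))
    (hRiem : ∀ t ∈ Ico 0 T, (g t).IsRiemannian) (hm : 0 < m) (hΛ : 0 < Λ) (hΦ : Λ + 1 ≤ Φ)
    (hρ₁ : 0 ≤ ρ₁) (hρ : ρ₁ < ρ) (hK : 0 ≤ K) (hL : 0 < L) (hQ : 2 ≤ Q)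
    (hinv : IsInvariant field (pinchingFamily m Λ Φ ρ₁ ρ Ψ K L P Q)) {t₀ : ℝ} (ht₀ : 0 ≤ t₀)
    (h0 : ∀ (x : M) (e : Fin 4 → TangentSpace (𝓡 4) x), (g 0).IsOrthonormalFrame x e →
      ((g 0).blockA (cov 0) x e, (g 0).blockB (cov 0) x e, (g 0).blockC (cov 0) x e) ∈
        pinchingFamily m Λ Φ ρ₁ ρ Ψ K L P Q t₀) :
    ∀ t ∈ Ico 0 T, ∀ (x : M) (e : Fin 4 → TangentSpace (𝓡 4) x),
      (g t).IsOrthonormalFrame x e →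
        Matrix.PinchedBy ((g t).blockA (cov t) x e) ((g t).blockB (cov t) x e)
            ((g t).blockC (cov t) x e) ρ (max ((Φ + 1) * (Ψ + 1)) L) ∧
          Matrix.ImprovedPinchingAt ((g t).blockA (cov t) x e) ((g t).blockB (cov t) x e)
            ((g t).blockC (cov t) x e) ρ (max ((Φ + 1) * (Ψ + 1)) L) P (t₀ + t) := by
  intro t ht x e he
  have hmem := mem_pinchingFamily_of_ricciFlow hflow hRiem hm.le hΛ.le hρ.le hK hL.le hQ hinv
    ht₀ h0 t ht x e he
  obtain ⟨h1, h2, -, -⟩ :=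
    pinchedBy_and_improvedPinchingAt_of_mem_pinchingFamily hm hΛ hΦ hρ₁ hρ hL.le hQ hmem
  exact ⟨h1, h2⟩

/-- **Every metric of a restarted stage has positive isotropic curvature** (the `pic` clause of
`ChenZhuAPriori`; Chen–Zhu 2006, Def. 5.1: "smooth solutions … with positive isotropic
curvature"): membership in Hamilton's family gives `a₁ + a₂ ≥ m > 0`, `c₁ + c₂ ≥ m` in every
frame at every time, hence positive isotropic curvature by Hamilton's Lemma A2.1
(`hasPositiveIsotropicCurvatureWith_of_blocks`), for every Levi-Civita connection of `g t` (they
have the same blocks, `blocks_eq_of_isLeviCivita`).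
[cite: ChenZhu2006, Def. 5.1 (p. 26)] [cite: Hamilton1997, §1.2, Lemma 2.1 (p. 5) and §2.1, Thm. 1.2 (p. 7)] -/
theorem stage_hasPositiveIsotropicCurvature_of_mem_pinchingFamily
    (hflow : IsRicciFlow g cov (Ico 0 T)) (hRiem : ∀ t ∈ Ico 0 T, (g t).IsRiemannian)
    (hm : 0 < m) (hΛ : 0 ≤ Λ) (hρ : ρ₁ ≤ ρ) (hK : 0 ≤ K) (hL : 0 ≤ L) (hQ : 2 ≤ Q)
    (hinv : IsInvariant field (pinchingFamily m Λ Φ ρ₁ ρ Ψ K L P Q)) {t₀ : ℝ} (ht₀ : 0 ≤ t₀)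
    (h0 : ∀ (x : M) (e : Fin 4 → TangentSpace (𝓡 4) x), (g 0).IsOrthonormalFrame x e →
      ((g 0).blockA (cov 0) x e, (g 0).blockB (cov 0) x e, (g 0).blockC (cov 0) x e) ∈
        pinchingFamily m Λ Φ ρ₁ ρ Ψ K L P Q t₀) :
    ∀ t ∈ Ico 0 T, (g t).HasPositiveIsotropicCurvature := by
  intro t ht cov' hcov'
  have hn : (2 : ℕ∞ω) ≤ ∞ := WithTop.coe_le_coe.mpr le_top
  have hmem := mem_pinchingFamily_of_ricciFlow hflow hRiem hm.le hΛ hρ hK hL hQ hinv ht₀ h0 t ht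
  refine hasPositiveIsotropicCurvatureWith_of_blocks hcov' hn fun x e he u v hu hv huv ↦ ?_
  obtain ⟨hA, -, -⟩ := blocks_eq_of_isLeviCivita (hflow.isLeviCivita t ht) hcov' x e
  rw [hA]
  obtain ⟨⟨⟨⟨⟨⟨⟨⟨⟨⟨⟨-, h1⟩, -⟩, -⟩, -⟩, -⟩, -⟩, -⟩, -⟩, -⟩, -⟩, -⟩ := hmem x e he
  have h1' : ((g t).blockA (cov t) x e).TwoSmallestEigenvaluesSumGE m := h1
  exact lt_of_lt_of_le hm (h1' u v hu hv huv)

end Stage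

end Literature.Geometry.Riemannian

end
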